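import Summits.QuantumAdvantage.AdviceFreeQNC0.LowDegFeatureWindow
import Summits.QuantumAdvantage.AdviceFreeQNC0.LocalRulesWithParities
import HarnessLib

/-!
# Cell qa-qnc0 (rung F-Q1, route RingFrame, crux α `RingToElim`): LOCAL RULES WITH ORACLE ACCESS
# TO A LINEAR NUMBER OF GLOBAL PARITIES (or of non-coupling low-degree features) are beaten

Corollaries of the K-feature window theorem at the Viola–Wigderson budget
(`lowDegFeatureWindow`, `LowDegFeatureWindow.lean`).  A walk strategy whose cuts strictly inside
a block `z` are LOCAL RULES WITH ORACLE ACCESS to `K` global Boolean features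
`Q_1, …, Q_K` — `y_g(u) = F_g(u|_{[g−r, g+r)}, Q_1(u), …, Q_K(u))` with an ARBITRARY combiner `F_g`
(only the total degree `≤ D ≤ c₁√M` of `y_g` is assumed) — is beaten as soon as the features have
degree `≤ d`, do not couple the far block `x` with `z` across the gap `h` (mixed differences
vanish: `Q(x,z) ⊕ Q(x',z) = Q(x,z') ⊕ Q(x',z')`, automatic for affine features and for every
polynomial whose monomials have diameter `≤ |h|`), and are at most `L/(2·4^d) − 3` in number:

* `xor_affine_window` — affine functions never couple two blocks;
* `ringWinU_localOverFeatures_window_le` — the window form for degree-`d` non-coupling features,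
  budget `2·4^d·(K+3) ≤ L`, `θ = 1 − η₀/4`;
* `ringWinU_localOverParities_window_le` — the case `d = 1` (`K` affine functions, `8(K+3) ≤ L`);
* `ringWinU_localOverFeatures_le`, `ringWinU_localOverParities_le` — polylog forms on `n` bits
  (degree and range `(log₂ n)^C`, `M ≥ (log₂ n)^{2C+1}`, `H ≥ (log₂ n)^C`, free window);
* `ringWinU_localRulesOverParities_le` — the headline: for all large `n`, EVERY strategy of degree
  `≤ (log₂ n)^C` all of whose selectors are local rules of range `(log₂ n)^C` with oracle access to
  `K` fixed affine functions of the input, **`16·(K + 3) ≤ n`**, wins on `≤ θ·2ⁿ` inputs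
  (window `x = [0, n/2)`; `K` up to `n/16 − 3` global parities).

Compare `ringWinU_localRulesWithParities_le` (T9/PLDAMS route, qn-prover-3 gen 4): there the
combiner had to be `local ⊕ parity of a subset` and the budget was `K·(log₂ n)^C ≤ c₁√L`
(`K ≲ √n/polylog`); here the combiner is arbitrary and `K` is linear in `n`.  The cell's theorem
(prover qn-prover-3 gen 5, 2026-08-27); not in print.  WHAT THIS IS NOT: nothing for features of
polylog degree or for features that couple distant blocks (general cross-reading = α proper); no
separation claim.

## References

* E. Viola, A. Wigderson, *Norms, XOR lemmas, and lower bounds for polynomials and protocols*,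
  Theory of Computing 4 (2008), Thm. 2.9 [ViolaWigderson2008].
* S. Srinivasan, *A robust version of Hegedűs's lemma, with applications*, TheoretiCS 2 (2023),
  Lemma 3.1 [Srinivasan2023].
-/

noncomputable section

namespace Summit.QuantumAdvantage.AdviceFreeQNC0

open Finset
open Literature.Computability.MetaComplexity Literature.Computability.MetaComplexity.Smolensky

variable {p L H M q : ℕ}

/-! ### Affine features do not couple blocks -/

/-- **Affine functions never couple two blocks**: for `ℓ` of degree `≤ 1` the mixed difference
across the `x`- and `z`-blocks of a window vanishes,
`ℓ(a x h z b) ⊕ ℓ(a x' h z b) = ℓ(a x h z' b) ⊕ ℓ(a x' h z' b)`. [folklore] -/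
theorem xor_affine_window {ℓ : (Fin (p + (L + H + M) + q) → Bool) → Bool} (hℓ : HasDeg ℓ 1)
    (a : Fin p → Bool) (h : Fin H → Bool) (b : Fin q → Bool) (x x' : Fin L → Bool)
    (z z' : Fin M → Bool) :
    xor (ℓ (glue3 a (glue3 x h z) b)) (ℓ (glue3 a (glue3 x' h z) b)) =
      xor (ℓ (glue3 a (glue3 x h z') b)) (ℓ (glue3 a (glue3 x' h z') b)) :=
  xor_eq_of_hasDeg_one hℓ _ _ _ _ fun i => xor_glue3_glue3_eq a a x x' h h z z' b b i

/-! ### The window form -/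

/-- **Local rules with oracle access to `K` non-coupling features of degree `d` (window form).**
There are `θ < 1`, `c₁ > 0`, `n₀` such that: for a window `a ++ x(L) ++ h(H) ++ z(M) ++ b` with
`M ≥ n₀`, `D ≤ c₁√M`, `2·4^d·(K+3) ≤ L`, `r ≤ H`, every charge, `K` features `Q_k` of degree
`≤ d` that do not couple the `x`-block with the `z`-block, and every walk strategy of degree `≤ D`
whose cuts strictly inside the `z`-block are local rules of range `r` with oracle access to the
`Q_k`, the ring game in walk coordinates is won on at most `θ·2ⁿ` inputs.
[cite: ViolaWigderson2008, Theorem 2.9; Srinivasan2023, Lemma 3.1] -/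
theorem ringWinU_localOverFeatures_window_le :
    ∃ θ : ℝ, θ < 1 ∧ ∃ c₁ : ℝ, 0 < c₁ ∧ ∃ n₀ : ℕ, ∀ p L H M q K d r : ℕ, n₀ ≤ M →
      ∀ D : ℕ, (D : ℝ) ≤ c₁ * Real.sqrt M → 2 * 4 ^ d * (K + 3) ≤ L → r ≤ H →
      ∀ (c : ℕ) (Q : Fin K → (Fin (p + (L + H + M) + q) → Bool) → Bool), (∀ k, HasDeg (Q k) d) →
      (∀ (k : Fin K) (a : Fin p → Bool) (h : Fin H → Bool) (b : Fin q → Bool) (x x' : Fin L → Bool)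
          (z z' : Fin M → Bool),
        xor (Q k (glue3 a (glue3 x h z) b)) (Q k (glue3 a (glue3 x' h z) b)) =
          xor (Q k (glue3 a (glue3 x h z') b)) (Q k (glue3 a (glue3 x' h z') b))) →
      ∀ (y : Fin (p + (L + H + M) + q + 1) → (Fin (p + (L + H + M) + q) → Bool) → Bool),
        (∀ g, HasDeg (y g) D) →
        (∀ g : Fin (p + (L + H + M) + q + 1), p + (L + H) < g.val → g.val < p + (L + H + M) →
          ∃ F : (Fin (p + (L + H + M) + q) → Bool) → (Fin K → Bool) → Bool,
            (∀ (u u' : Fin (p + (L + H + M) + q) → Bool) (v : Fin K → Bool),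
              (∀ i : Fin (p + (L + H + M) + q), g.val ≤ i.val + r → i.val < g.val + r → u i = u' i) →
                F u v = F u' v) ∧
            ∀ u, y g u = F u (fun k => Q k u)) →
        ((univ.filter fun u : Fin (p + (L + H + M) + q) → Bool => ringWinU c y u = true).card : ℝ) ≤
          θ * (2 : ℝ) ^ (p + (L + H + M) + q) := by
  classical
  obtain ⟨θ, hθ, c₁, hc₁, n₀, HT⟩ := lowDegFeatureWindow
  refine ⟨θ, hθ, c₁, hc₁, n₀, ?_⟩
  intro p L H M q K d r hM D hD hKL hrH c Q hQ hnc y hdeg hloc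
  refine HT p L H M q K d hM D hD hKL c y hdeg fun a h b => ?_
  -- the features: the `Q_k` restricted to the `x`-block at the reference `z₀ = 0`
  set z₀ : Fin M → Bool := fun _ => false with hz₀
  refine ⟨fun k x => Q k (glue3 a (glue3 x h z₀) b), fun k => ?_, ?_⟩
  · -- degree of a feature: restriction of `Q k`
    have h1 : HasDeg (fun w : Fin (L + H + M) → Bool => Q k (glue3 a w b)) d :=
      hasDeg_glue3_window a b (hQ k)
    have h2 : HasDeg (fun xh : Fin (L + H) → Bool => Q k (glue3 a (Fin.append xh z₀) b)) d :=
      hasDeg_append_left z₀ h1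
    exact hasDeg_append_left h h2
  · intro g hg1 hg2 x x' z hxx'
    obtain ⟨F, hF, hyF⟩ := hloc g hg1 hg2
    rw [hyF, hyF]
    -- the local part does not see the `x`-block
    have hloc' : F (glue3 a (glue3 x h z) b) (fun k => Q k (glue3 a (glue3 x h z) b)) =
        F (glue3 a (glue3 x' h z) b) (fun k => Q k (glue3 a (glue3 x h z) b)) :=
      hF _ _ _ fun i hi1 hi2 => glue3_glue3_eq_off_x a x x' h z b i (by omega)
    rw [hloc']
    -- the features agree: no coupling, and agreement at the reference column
    have hQeq : (fun k => Q k (glue3 a (glue3 x h z) b)) = fun k => Q k (glue3 a (glue3 x' h z) b) := by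
      funext k
      have h1 := hnc k a h b x x' z z₀
      have hk : Q k (glue3 a (glue3 x h z₀) b) = Q k (glue3 a (glue3 x' h z₀) b) := hxx' k
      have h2 : xor (Q k (glue3 a (glue3 x h z₀) b)) (Q k (glue3 a (glue3 x' h z₀) b)) = false := by
        rw [hk, Bool.xor_self]
      rw [h2] at h1
      revert h1
      cases Q k (glue3 a (glue3 x h z) b) <;> cases Q k (glue3 a (glue3 x' h z) b) <;> simp
    rw [hQeq]

/-- **Local rules with oracle access to `K` global affine functions (window form, `d = 1`).**
Window `a ++ x(L) ++ h(H) ++ z(M) ++ b`, `M ≥ n₀`, `D ≤ c₁√M`, `8(K+3) ≤ L`, `r ≤ H`; the cuts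
strictly inside the `z`-block are `F_g(u|_{[g−r,g+r)}, ℓ_1(u), …, ℓ_K(u))` with arbitrary
combiners `F_g` and affine `ℓ_k`; all selectors of degree `≤ D`.  Then `#WIN ≤ θ·2ⁿ`.
[cite: ViolaWigderson2008, Theorem 2.9; Srinivasan2023, Lemma 3.1] -/
theorem ringWinU_localOverParities_window_le :
    ∃ θ : ℝ, θ < 1 ∧ ∃ c₁ : ℝ, 0 < c₁ ∧ ∃ n₀ : ℕ, ∀ p L H M q K r : ℕ, n₀ ≤ M →
      ∀ D : ℕ, (D : ℝ) ≤ c₁ * Real.sqrt M → 8 * (K + 3) ≤ L → r ≤ H →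
      ∀ (c : ℕ) (ℓ : Fin K → (Fin (p + (L + H + M) + q) → Bool) → Bool), (∀ k, HasDeg (ℓ k) 1) →
      ∀ (y : Fin (p + (L + H + M) + q + 1) → (Fin (p + (L + H + M) + q) → Bool) → Bool),
        (∀ g, HasDeg (y g) D) →
        (∀ g : Fin (p + (L + H + M) + q + 1), p + (L + H) < g.val → g.val < p + (L + H + M) →
          ∃ F : (Fin (p + (L + H + M) + q) → Bool) → (Fin K → Bool) → Bool,
            (∀ (u u' : Fin (p + (L + H + M) + q) → Bool) (v : Fin K → Bool),
              (∀ i : Fin (p + (L + H + M) + q), g.val ≤ i.val + r → i.val < g.val + r → u i = u' i) →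
                F u v = F u' v) ∧
            ∀ u, y g u = F u (fun k => ℓ k u)) →
        ((univ.filter fun u : Fin (p + (L + H + M) + q) → Bool => ringWinU c y u = true).card : ℝ) ≤
          θ * (2 : ℝ) ^ (p + (L + H + M) + q) := by
  obtain ⟨θ, hθ, c₁, hc₁, n₀, HF⟩ := ringWinU_localOverFeatures_window_le
  refine ⟨θ, hθ, c₁, hc₁, n₀, ?_⟩
  intro p L H M q K r hM D hD hKL hrH c ℓ hℓ y hdeg hloc
  have hKL' : 2 * 4 ^ 1 * (K + 3) ≤ L := by omega
  exact HF p L H M q K 1 r hM D hD hKL' hrH c ℓ hℓ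
    (fun k a h b x x' z z' => xor_affine_window (hℓ k) a h b x x' z z') y hdeg hloc

/-! ### The polylog forms -/

/-- Degree bookkeeping: `k^C ≤ c₁·√M` once `c₁·√k ≥ 1` and `M ≥ k^{2C+1}`. -/
private theorem pow_le_mul_sqrt₅ {c₁ : ℝ} (hc₁ : 0 < c₁) {k C M : ℕ} (hck : 1 ≤ c₁ * Real.sqrt k)
    (hM : k ^ (2 * C + 1) ≤ M) : ((k ^ C : ℕ) : ℝ) ≤ c₁ * Real.sqrt M := by
  have hsqrt : (k : ℝ) ^ C * Real.sqrt k ≤ Real.sqrt M := by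
    have h2 : ((k ^ (2 * C + 1) : ℕ) : ℝ) ≤ M := by exact_mod_cast hM
    have h1 : ((k : ℝ) ^ C) ^ 2 * k ≤ M := by
      calc ((k : ℝ) ^ C) ^ 2 * k = (k : ℝ) ^ (2 * C + 1) := by ring
        _ ≤ M := by push_cast at h2; exact h2
    calc (k : ℝ) ^ C * Real.sqrt k = Real.sqrt (((k : ℝ) ^ C) ^ 2 * k) := by
          rw [Real.sqrt_mul (by positivity), Real.sqrt_sq (by positivity)]
      _ ≤ Real.sqrt M := Real.sqrt_le_sqrt h1
  push_cast
  calc (k : ℝ) ^ C = (k : ℝ) ^ C * 1 := (mul_one _).symm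
    _ ≤ (k : ℝ) ^ C * (c₁ * Real.sqrt k) := mul_le_mul_of_nonneg_left hck (by positivity)
    _ = c₁ * ((k : ℝ) ^ C * Real.sqrt k) := by ring
    _ ≤ c₁ * Real.sqrt M := mul_le_mul_of_nonneg_left hsqrt hc₁.le

/-- `c₁ √k ≥ 1` once `k ≥ ⌈1/c₁²⌉ + 1`. -/
private theorem one_le_mul_sqrt₅ {c₁ : ℝ} (hc₁ : 0 < c₁) {k : ℕ} (hk : ⌈1 / c₁ ^ 2⌉₊ + 1 ≤ k) :
    1 ≤ c₁ * Real.sqrt k := by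
  have h2 : ((⌈1 / c₁ ^ 2⌉₊ : ℕ) : ℝ) + 1 ≤ k := by exact_mod_cast hk
  have h3 : (1 / c₁ ^ 2 : ℝ) ≤ ((⌈1 / c₁ ^ 2⌉₊ : ℕ) : ℝ) := Nat.le_ceil _
  have h1 : (1 / c₁ ^ 2 : ℝ) ≤ k := by linarith
  rw [div_le_iff₀ (by positivity)] at h1
  calc (1 : ℝ) = Real.sqrt 1 := Real.sqrt_one.symm
    _ ≤ Real.sqrt (c₁ ^ 2 * k) := Real.sqrt_le_sqrt (by linarith)
    _ = c₁ * Real.sqrt k := by rw [Real.sqrt_mul (by positivity), Real.sqrt_sq hc₁.le]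

/-- **LOCAL RULES WITH ORACLE ACCESS TO NON-COUPLING FEATURES (polylog form).**  There is
`θ < 1` such that for every `C` and all large `n`: a walk strategy on `n` bits of degree
`≤ (log₂ n)^C` admitting a window `[p, p+L) ++ [p+L, p+L+H) ++ [p+L+H, p+L+H+M)` with
`M ≥ (log₂ n)^{2C+1}`, `H ≥ (log₂ n)^C`, `2·4^d·(K+3) ≤ L`, whose cuts strictly inside the third
block are local rules of range `(log₂ n)^C` with oracle access to `K` degree-`d` features of the
input that do not couple the first block with the third, wins on at most `θ·2ⁿ` inputs, every
charge. [cite: ViolaWigderson2008, Theorem 2.9; Srinivasan2023, Lemma 3.1] -/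
theorem ringWinU_localOverFeatures_le :
    ∃ θ : ℝ, θ < 1 ∧ ∀ C : ℕ, ∃ n₀ : ℕ, ∀ n ≥ n₀, ∀ p L H M K d : ℕ,
      p + (L + H + M) ≤ n → (Nat.log 2 n) ^ (2 * C + 1) ≤ M → (Nat.log 2 n) ^ C ≤ H →
      2 * 4 ^ d * (K + 3) ≤ L →
      ∀ (c : ℕ) (Q : Fin K → (Fin n → Bool) → Bool), (∀ k, HasDeg (Q k) d) →
      (∀ (k : Fin K) (u u' v v' : Fin n → Bool),
        (∀ i : Fin n, ¬ (p ≤ i.val ∧ i.val < p + L) → u i = u' i ∧ v i = v' i) →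
        (∀ i : Fin n, ¬ (p + (L + H) ≤ i.val ∧ i.val < p + (L + H + M)) → u i = v i ∧ u' i = v' i) →
          xor (Q k u) (Q k u') = xor (Q k v) (Q k v')) →
      ∀ y : Fin (n + 1) → (Fin n → Bool) → Bool, (∀ g, HasDeg (y g) ((Nat.log 2 n) ^ C)) →
        (∀ g : Fin (n + 1), p + (L + H) < g.val → g.val < p + (L + H + M) →
          ∃ F : (Fin n → Bool) → (Fin K → Bool) → Bool,
            (∀ (u u' : Fin n → Bool) (v : Fin K → Bool), (∀ i : Fin n,
              g.val ≤ i.val + (Nat.log 2 n) ^ C → i.val < g.val + (Nat.log 2 n) ^ C → u i = u' i) →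
                F u v = F u' v) ∧
            ∀ u, y g u = F u (fun k => Q k u)) →
        ((univ.filter fun u : Fin n → Bool => ringWinU c y u = true).card : ℝ) ≤ θ * (2 : ℝ) ^ n := by
  obtain ⟨θ, hθ, c₁, hc₁, ℓ₀, Hsq⟩ := ringWinU_localOverFeatures_window_le
  refine ⟨θ, hθ, fun C => ⟨2 ^ (max (ℓ₀ + 1) (⌈1 / c₁ ^ 2⌉₊ + 1)), ?_⟩⟩
  intro n hn p L H M K d hpn hM hH hKL c Q hQ hnc y hdeg hloc
  obtain ⟨q, rfl⟩ : ∃ q, n = p + (L + H + M) + q := ⟨n - (p + (L + H + M)), by omega⟩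
  set k := Nat.log 2 (p + (L + H + M) + q) with hk
  have hm : max (ℓ₀ + 1) (⌈1 / c₁ ^ 2⌉₊ + 1) ≤ k := Nat.le_log_of_pow_le one_lt_two hn
  have hkℓ : ℓ₀ + 1 ≤ k := le_trans (le_max_left _ _) hm
  have hk1 : ⌈1 / c₁ ^ 2⌉₊ + 1 ≤ k := le_trans (le_max_right _ _) hm
  have hkk : k ≤ k ^ (2 * C + 1) := Nat.le_self_pow (by omega) k
  have hℓ₀M : ℓ₀ ≤ M := by omega
  have hck := one_le_mul_sqrt₅ hc₁ hk1
  have hDM := pow_le_mul_sqrt₅ (C := C) hc₁ hck hM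
  refine Hsq p L H M q K d (k ^ C) hℓ₀M (k ^ C) hDM hKL hH c Q hQ ?_ y hdeg hloc
  -- no coupling on the window, from the pointwise form
  intro kk a h b x x' z z'
  refine hnc kk (glue3 a (glue3 x h z) b) (glue3 a (glue3 x' h z) b) (glue3 a (glue3 x h z') b)
    (glue3 a (glue3 x' h z') b) (fun i hi => ?_) (fun i hi => ?_)
  · exact ⟨glue3_glue3_eq_off_x a x x' h z b i hi, glue3_glue3_eq_off_x a x x' h z' b i hi⟩
  · constructor
    · exact glue3_glue3_eq_off_z a x h z z' b i hi
    · exact glue3_glue3_eq_off_z a x' h z z' b i hi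

/-- **LOCAL RULES WITH ORACLE ACCESS TO GLOBAL PARITIES (polylog form).**  There is `θ < 1`
such that for every `C` and all large `n`: a walk strategy on `n` bits of degree `≤ (log₂ n)^C`
admitting a window `[p, p+L) ++ [p+L, p+L+H) ++ [p+L+H, p+L+H+M)` with `M ≥ (log₂ n)^{2C+1}`,
`H ≥ (log₂ n)^C`, `8(K+3) ≤ L`, whose cuts strictly inside the third block are local rules of range
`(log₂ n)^C` with oracle access to `K` fixed affine functions of the input, wins on at most `θ·2ⁿ`
inputs, every charge. [cite: ViolaWigderson2008, Theorem 2.9; Srinivasan2023, Lemma 3.1] -/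
theorem ringWinU_localOverParities_le :
    ∃ θ : ℝ, θ < 1 ∧ ∀ C : ℕ, ∃ n₀ : ℕ, ∀ n ≥ n₀, ∀ p L H M K : ℕ,
      p + (L + H + M) ≤ n → (Nat.log 2 n) ^ (2 * C + 1) ≤ M → (Nat.log 2 n) ^ C ≤ H →
      8 * (K + 3) ≤ L →
      ∀ (c : ℕ) (ℓ : Fin K → (Fin n → Bool) → Bool), (∀ k, HasDeg (ℓ k) 1) →
      ∀ y : Fin (n + 1) → (Fin n → Bool) → Bool, (∀ g, HasDeg (y g) ((Nat.log 2 n) ^ C)) →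
        (∀ g : Fin (n + 1), p + (L + H) < g.val → g.val < p + (L + H + M) →
          ∃ F : (Fin n → Bool) → (Fin K → Bool) → Bool,
            (∀ (u u' : Fin n → Bool) (v : Fin K → Bool), (∀ i : Fin n,
              g.val ≤ i.val + (Nat.log 2 n) ^ C → i.val < g.val + (Nat.log 2 n) ^ C → u i = u' i) →
                F u v = F u' v) ∧
            ∀ u, y g u = F u (fun k => ℓ k u)) →
        ((univ.filter fun u : Fin n → Bool => ringWinU c y u = true).card : ℝ) ≤ θ * (2 : ℝ) ^ n := by
  obtain ⟨θ, hθ, c₁, hc₁, ℓ₀, Hsq⟩ := ringWinU_localOverParities_window_le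
  refine ⟨θ, hθ, fun C => ⟨2 ^ (max (ℓ₀ + 1) (⌈1 / c₁ ^ 2⌉₊ + 1)), ?_⟩⟩
  intro n hn p L H M K hpn hM hH hKL c ℓ hℓ y hdeg hloc
  obtain ⟨q, rfl⟩ : ∃ q, n = p + (L + H + M) + q := ⟨n - (p + (L + H + M)), by omega⟩
  set k := Nat.log 2 (p + (L + H + M) + q) with hk
  have hm : max (ℓ₀ + 1) (⌈1 / c₁ ^ 2⌉₊ + 1) ≤ k := Nat.le_log_of_pow_le one_lt_two hn
  have hkℓ : ℓ₀ + 1 ≤ k := le_trans (le_max_left _ _) hm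
  have hk1 : ⌈1 / c₁ ^ 2⌉₊ + 1 ≤ k := le_trans (le_max_right _ _) hm
  have hkk : k ≤ k ^ (2 * C + 1) := Nat.le_self_pow (by omega) k
  have hℓ₀M : ℓ₀ ≤ M := by omega
  have hck := one_le_mul_sqrt₅ hc₁ hk1
  have hDM := pow_le_mul_sqrt₅ (C := C) hc₁ hck hM
  exact Hsq p L H M q K (k ^ C) hℓ₀M (k ^ C) hDM hKL hH c ℓ hℓ y hdeg hloc

/-! ### The headline: local rules over `n/16` global parities -/

/-- Room: `4·(log₂ n)^{2C+1} ≤ n` for all large `n`. -/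
private theorem four_mul_logPow_le (C : ℕ) : ∃ n₀ : ℕ, ∀ n ≥ n₀, 4 * (Nat.log 2 n) ^ (2 * C + 1) ≤ n := by
  obtain ⟨n₂, hn₂⟩ := logPow_le_sqrt' (2 * C + 1) (c₀ := 1 / 4) (by norm_num)
  refine ⟨max n₂ 2, fun n hn => ?_⟩
  have hn₂n : n₂ ≤ n := le_trans (le_max_left _ _) hn
  have hn2 : 2 ≤ n := le_trans (le_max_right _ _) hn
  have h1 : (((Nat.log 2 n) ^ (2 * C + 1) : ℕ) : ℝ) ≤ 1 / 4 * Real.sqrt n := hn₂ n hn₂n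
  have h2 : Real.sqrt n ≤ n := by
    have hn1 : (1 : ℝ) ≤ n := by exact_mod_cast (le_trans (by norm_num) hn2)
    calc Real.sqrt n ≤ Real.sqrt n * Real.sqrt n :=
          le_mul_of_one_le_right (Real.sqrt_nonneg _) (by rw [← Real.sqrt_one]; exact Real.sqrt_le_sqrt hn1)
      _ = n := Real.mul_self_sqrt (by positivity)
  have h3 : ((4 * (Nat.log 2 n) ^ (2 * C + 1) : ℕ) : ℝ) ≤ n := by push_cast at h1 ⊢; linarith
  exact_mod_cast h3

/-- **LOCAL RULES WITH ORACLE ACCESS TO `n/16` GLOBAL PARITIES ARE BEATEN.**  There is `θ < 1`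
such that for every `C` and all large `n`: for every `K` with `16·(K+3) ≤ n`, every `K` affine
Boolean functions `ℓ_1, …, ℓ_K` of the input, every charge, and every walk strategy of degree
`≤ (log₂ n)^C` EACH of whose selectors is a local rule of range `(log₂ n)^C` with oracle access to
`ℓ_1(u), …, ℓ_K(u)` (arbitrary combiners), the ring game in walk coordinates is won on at most
`θ·2ⁿ` inputs. [cite: ViolaWigderson2008, Theorem 2.9; Srinivasan2023, Lemma 3.1] -/
theorem ringWinU_localRulesOverParities_le :
    ∃ θ : ℝ, θ < 1 ∧ ∀ C : ℕ, ∃ n₀ : ℕ, ∀ n ≥ n₀, ∀ K : ℕ, 16 * (K + 3) ≤ n →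
      ∀ (c : ℕ) (ℓ : Fin K → (Fin n → Bool) → Bool), (∀ k, HasDeg (ℓ k) 1) →
      ∀ y : Fin (n + 1) → (Fin n → Bool) → Bool, (∀ g, HasDeg (y g) ((Nat.log 2 n) ^ C)) →
        (∀ g : Fin (n + 1), ∃ F : (Fin n → Bool) → (Fin K → Bool) → Bool,
            (∀ (u u' : Fin n → Bool) (v : Fin K → Bool), (∀ i : Fin n,
              g.val ≤ i.val + (Nat.log 2 n) ^ C → i.val < g.val + (Nat.log 2 n) ^ C → u i = u' i) →
                F u v = F u' v) ∧
            ∀ u, y g u = F u (fun k => ℓ k u)) →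
        ((univ.filter fun u : Fin n → Bool => ringWinU c y u = true).card : ℝ) ≤ θ * (2 : ℝ) ^ n := by
  obtain ⟨θ, hθ, Hpoly⟩ := ringWinU_localOverParities_le
  refine ⟨θ, hθ, fun C => ?_⟩
  obtain ⟨n₁, hn₁⟩ := Hpoly C
  obtain ⟨n₂, hn₂⟩ := four_mul_logPow_le C
  refine ⟨max n₁ (max n₂ 2), fun n hn K hK c ℓ hℓ y hdeg hloc => ?_⟩
  have hn₁n : n₁ ≤ n := le_trans (le_max_left _ _) hn
  have hn₂n : n₂ ≤ n := le_trans (le_trans (le_max_left _ _) (le_max_right _ _)) hn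
  have hn2 : 2 ≤ n := le_trans (le_trans (le_max_right _ _) (le_max_right _ _)) hn
  set k := Nat.log 2 n with hk
  have hk1 : 1 ≤ k := Nat.le_log_of_pow_le one_lt_two (by simpa using hn2)
  have hroom : 4 * k ^ (2 * C + 1) ≤ n := hn₂ n hn₂n
  have hkC : k ^ C ≤ k ^ (2 * C + 1) := Nat.pow_le_pow_right hk1 (by omega)
  -- the window: `x = [0, n/2)`, `h` of length `k^C`, `z` of length `k^{2C+1}`
  have hfit : 0 + (n / 2 + k ^ C + k ^ (2 * C + 1)) ≤ n := by omega
  have hKL : 8 * (K + 3) ≤ n / 2 := by omega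
  exact hn₁ n hn₁n 0 (n / 2) (k ^ C) (k ^ (2 * C + 1)) K hfit le_rfl le_rfl hKL c ℓ hℓ y hdeg
    fun g _ _ => hloc g

end Summit.QuantumAdvantage.AdviceFreeQNC0

end
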